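import Summits.QuantumFields.BalabanUV.T4Continuum.Support.NE7FrameFreeRightInverse
import HarnessLib

/-!
# NE7SliceIterationStateNL0 — THE STATE OF THE (S1) ITERATION ON THE NONLINEAR FRAME TARGET WITH THE FRAME-FREE RIGHT INVERSE (memo ROAD-G103 §6, repair (R1″), file (C1)-1):
# VERBATIM `NE7SliceIterationStateNL` with row NE3's `rightInvW` replaced by `NE7FrameFreeRightInverse.rightInvW0` (`dirIter R₀ = id`, `framePotW R₀ = 0` exactly)

Cell `pub-balaban`, rung (B)+1 sub-cell t4, lineage `b2b-balaban-t4-ne7-p1`, generation 103 (CRUX PROVER NE7 #1 = OWNER of BINDER row NE7).  Memo `t4/b2b-balaban-t4-ne7-p1-g103/ROAD-G103.md` §6.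
WHY (FINDING-2).  With `rightInvW` the engine's fixed point has `mlog v_{k+1}(X⋆) = h⋆ + framePotW Ñ⋆`; with the frame-free `R₀` (`framePotW ∘ R₀ = 0`) the mismatch `m̃(u) = sup‖framePotW T̃(u) − h̃(u)‖`
IS `sup‖mlog v_{k+1}(X(u)) − h(u)‖`, so the fixed point satisfies [Balaban1985RegularSpaces] (1.37) EXACTLY (`v_{k+1} =` the corner transformation), the double-bar average of the representative is
`1` (`NE7SliceDoubleBar.dbavgCovIter_state_eq_one_iff`) and [B8]'s k-free letters apply to `φ̃⋆ = QbarIter X⋆` by name.  The datum `φ̃`, the frame defect `P` and the effective corner logarithm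
`h̃` are those of `NE7SliceIterationStateNL` (REUSED BY NAME); only the maps downstream of the right inverse are re-issued, with ONE extra def-parameter
`hE : 4d²(M−1)²x + 16d·loopRad d L (prop1Radius^[k] x) ≤ 1∕2` (the squared-tent fix's half-scalar regime) after `hθ`.
WHAT ([folklore]; 7 def, 0 sorry).  `normalPartNL0`, `normalPartNL0_eq`, `tangentPartNL0`, `gaugeFunNL0`, `slicePartNL0`, `splitNL0_spec`, `frameMismatchNL0`, `sliceDefectNL0`, `sliceStepNL0`,
`sliceDefectNL0_nonneg`, `sliceStepNL0_apply`.
HONEST FRAMING (page 1): definitions and bookkeeping; NO estimate; nothing of Bałaban's asserted; NOT (S1), NOT NE7; spine 0∕9; finite T⁴ rung (B)+1 — NOT infinite volume, NOT mass gap,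
NOT BetaPertH, NOT Clay.  Continuum YM on T⁴ ⇐ BetaPertH ∧ nine spine estimates (0/9 proved); BetaPertH ⇐ (D1) ∧ (D4) ∧ CAP+tail; G-an2-4 gates asym, D1 and NE2/3/4.
-/

set_option autoImplicit false

open scoped BigOperators Matrix.Norms.L2Operator
open Finset

namespace Summit.QuantumFields.BalabanUV.T4Continuum.NE7SliceIterationStateNL0

open Literature.MathematicalPhysics.QuantumFieldTheory.Balaban1983to89
open B7Prop1Explicit B7Prop2Explicit MatrixLog
open B7Eq92Concrete (vcov)
open T4AveragingDeficitWall (IsUnitaryCfg IsSkewDir SmallField)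
open T4AveragingDeficitWallBoundary (periodBox)
open AveragingDeficitMultiLevelPrep (cavgIter LevelSmall tower)
open BlockAveragePushDirGauge (gaugeDir)
open NE3TangentCovariantTower (dirIter framePotW)
open NE3TangentCovariantStructure (gaugeDir_add_fun)
open NE3QbarIterCovLiftPrep (cruxC)
open NE7FrameFreeRightInverse (rightInvW0)
open NE7SliceIterationStateNL (frameDefect effCornerLog coarseDatumNL)
open SpreadLift (loopRad)
open AveragingDeficitTwoLevelPrep (prop1Radius)
open NE3.PairLandauB8Avg (relPert)
open NE7SliceIterationState (siteSup siteSup_nonneg bondSup bondSup_nonneg repLog cornerLog coarseDatum IsNormalisedSplit)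

noncomputable section

variable {d : ℕ} {n : Type*} [Fintype n] [DecidableEq n]

/-! ## §2 The state maps on the nonlinear target -/

section State

variable [Nonempty n] {L : ℕ} (hL : 2 ≤ L) (k : ℕ) {W : Site d → Fin d → (Matrix n n ℂ)ˣ} {x : ℝ} (hWu : IsUnitaryCfg W) (hx : 0 ≤ x) (hs : LevelSmall d L k x)
  (hWx : SmallField W x) (N : ℕ) [NeZero N] (hθ : cruxC d L * (((L : ℝ) ^ (k + 1)) ^ 2 * x) < 1)
  (hE : 4 * (d : ℝ) ^ 2 * ((L : ℝ) ^ (k + 1) - 1) ^ 2 * x + 16 * d * loopRad d L ((prop1Radius d L)^[k] x) ≤ 1 / 2) (U' : Site d → Fin d → (Matrix n n ℂ)ˣ)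

open Classical in
/-- **`Ñ(u)`**: the normal part `rightInvW0 φ̃(u)` (defined when `φ̃(u)` is skew — true on the working region —, else `0`). [folklore] -/
def normalPartNL0 (u : Site d → (Matrix n n ℂ)ˣ) : Site d → Fin d → Matrix n n ℂ :=
  if hφ : IsSkewDir (coarseDatumNL L k W U' u) then rightInvW0 hL k hWu hx hs hWx N hθ hE hφ else fun _ _ => 0

/-- on the working region `Ñ(u) = rightInvW0 φ̃(u)` (any skewness witness). [folklore] -/
theorem normalPartNL0_eq {u : Site d → (Matrix n n ℂ)ˣ} (hφ : IsSkewDir (coarseDatumNL L k W U' u)) :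
    normalPartNL0 hL k hWu hx hs hWx N hθ hE U' u = rightInvW0 hL k hWu hx hs hWx N hθ hE hφ := by
  rw [normalPartNL0, dif_pos hφ]

/-- **`T̃(u)`**: the tangent part `X(u) − Ñ(u)` (so `dirIter T̃(u) = gaugeDir_V h̃(u)` on the working region, `dirIter_rightInvW`). [folklore] -/
def tangentPartNL0 (u : Site d → (Matrix n n ℂ)ˣ) : Site d → Fin d → Matrix n n ℂ :=
  fun y κ => repLog W U' u y κ - normalPartNL0 hL k hWu hx hs hWx N hθ hE U' u y κ

open Classical in
/-- **`ζ̃(u)`**: the gauge function of a CHOSEN normalised split of `(T̃(u), h̃(u))` (`0` if none exists; its `gaugeDir W ζ̃(u)` is canonical, `NE7SliceSplitUnique.slice_split_unique`). [folklore] -/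
def gaugeFunNL0 (u : Site d → (Matrix n n ℂ)ˣ) : Site d → Matrix n n ℂ :=
  if h : ∃ p : (Site d → Matrix n n ℂ) × (Site d → Fin d → Matrix n n ℂ),
      IsNormalisedSplit L k N W (tangentPartNL0 hL k hWu hx hs hWx N hθ hE U' u) (effCornerLog L k W U' u) p.1 p.2 then (Classical.choose h).1
  else fun _ => 0

open Classical in
/-- **`Ỹ(u)`** on the nonlinear target: the slice part of the chosen normalised split (`T̃(u)` itself if none exists). [folklore] -/
def slicePartNL0 (u : Site d → (Matrix n n ℂ)ˣ) : Site d → Fin d → Matrix n n ℂ :=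
  if h : ∃ p : (Site d → Matrix n n ℂ) × (Site d → Fin d → Matrix n n ℂ),
      IsNormalisedSplit L k N W (tangentPartNL0 hL k hWu hx hs hWx N hθ hE U' u) (effCornerLog L k W U' u) p.1 p.2 then (Classical.choose h).2
  else tangentPartNL0 hL k hWu hx hs hWx N hθ hE U' u

/-- the chosen pair IS a normalised split of `(T̃(u), h̃(u))` whenever one exists. [folklore] -/
theorem splitNL0_spec {u : Site d → (Matrix n n ℂ)ˣ}
    (h : ∃ p : (Site d → Matrix n n ℂ) × (Site d → Fin d → Matrix n n ℂ),
      IsNormalisedSplit L k N W (tangentPartNL0 hL k hWu hx hs hWx N hθ hE U' u) (effCornerLog L k W U' u) p.1 p.2) :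
    IsNormalisedSplit L k N W (tangentPartNL0 hL k hWu hx hs hWx N hθ hE U' u) (effCornerLog L k W U' u)
      (gaugeFunNL0 hL k hWu hx hs hWx N hθ hE U' u) (slicePartNL0 hL k hWu hx hs hWx N hθ hE U' u) := by
  rw [gaugeFunNL0, slicePartNL0, dif_pos h, dif_pos h]
  exact Classical.choose_spec h

/-- **`m̃(u)`**: the frame mismatch on the nonlinear target, `sup_z ‖framePotW T̃(u) z − h̃(u) z‖` (box sup over the coarse period `N`); since `h̃ = h − P` and `framePotW T̃ = framePotW X − framePotW Ñ`
in the class, this is `sup_z ‖mlog v_{k+1}(X(u))(z) − framePotW Ñ(u) z − h(u) z‖` — the (1.37)-defect up to the N-frame. [folklore] -/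
def frameMismatchNL0 (u : Site d → (Matrix n n ℂ)ˣ) : ℝ :=
  siteSup N fun z => ‖framePotW L (k + 1) W (tangentPartNL0 hL k hWu hx hs hWx N hθ hE U' u) z - effCornerLog L k W U' u z‖

/-- **`D̃f(u)`**: the defect `δ̃(u) + m̃(u)∕M`, `δ̃(u) := sup‖gaugeDir W ζ̃(u)‖` (box sup over the fine period), `M = L^{k+1}`. [folklore] -/
def sliceDefectNL0 (u : Site d → (Matrix n n ℂ)ˣ) : ℝ :=
  bondSup (tower L N (k + 1)) (fun y μ => ‖gaugeDir W (gaugeFunNL0 hL k hWu hx hs hWx N hθ hE U' u) y μ‖)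
    + frameMismatchNL0 hL k hWu hx hs hWx N hθ hE U' u / (L : ℝ) ^ (k + 1)

/-- **THE STEP** `u ↦ e^{−ζ̃(u)}·u`. [folklore] -/
def sliceStepNL0 (u : Site d → (Matrix n n ℂ)ˣ) : Site d → (Matrix n n ℂ)ˣ :=
  (fun y => expUnit (-gaugeFunNL0 hL k hWu hx hs hWx N hθ hE U' u y)) * u

/-- the defect is nonnegative (`L ≥ 2`). [folklore] -/
theorem sliceDefectNL0_nonneg (u : Site d → (Matrix n n ℂ)ˣ) : 0 ≤ sliceDefectNL0 hL k hWu hx hs hWx N hθ hE U' u := by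
  have hM : 0 < (L : ℝ) ^ (k + 1) := pow_pos (by exact_mod_cast (by omega : 0 < L)) _
  exact add_nonneg (bondSup_nonneg fun y μ => norm_nonneg _) (div_nonneg (siteSup_nonneg fun z => norm_nonneg _) hM.le)

/-- `sliceStepNL0 u y = e^{−ζ̃(u)(y)}·u(y)`. [folklore] -/
theorem sliceStepNL0_apply (u : Site d → (Matrix n n ℂ)ˣ) (y : Site d) :
    sliceStepNL0 hL k hWu hx hs hWx N hθ hE U' u y = expUnit (-gaugeFunNL0 hL k hWu hx hs hWx N hθ hE U' u y) * u y := rfl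

end State

end

end Summit.QuantumFields.BalabanUV.T4Continuum.NE7SliceIterationStateNL0
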